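import Summits.QuantumAdvantage.QuantumAdvantage.Theorems.LinnikCubicClassGroupsDegreeOnePrimesEscapeConjClassShortIntervalDH
import Summits.QuantumAdvantage.QuantumAdvantage.Theorems.LinnikCubicClassGroupsDegreeOnePrimesEscapeConjClassShortIntervalCorollaries
import HarnessLib

/-!
# Primes with prescribed Frobenius class in every short interval of the Linnik range — every class,
# every Galois number field, unconditionally

Topic `Summits/QuantumAdvantage/QuantumAdvantage/Theorems`, cell B2b-1 (linnik-cubic), PART A (gen 17); helper
toward the crux `DegreeOnePrimesEscape` (stmt-QuantumAdvantage-11543) of route `LinnikCubicClassGroups`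
(value = theorem, NOT summit progress).

**Theorem (`exists_prime_frobenius_mem_shortInterval_all`).**  For every `n > 1` there are `δ, L > 0` such that
for every Galois number field `N/ℚ` of degree `n`, every `σ ∈ Gal(N/ℚ)`, every `x ≥ |d_N|^L` and every `h` with
`x^{1−δ} ≤ h ≤ x`, the interval `(x, x+h]` contains a prime `p ∤ d_N` with `Frob_p ∈ C(σ)`.
No hypothesis on exceptional zeros: in the flat regime (`ζ_{N^{⟨σ⟩}}(β₁) = 0`) the Deuring–Heilbronn-sharp
theorem `frobeniusClass_shortInterval_dh` has error relative to the flat main term `δ_C (h − I) > 0`.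
This sharpens `exists_prime_frobenius_mem_shortInterval` (which needed `ζ_{N^{⟨σ⟩}}(β₁) ≠ 0`) and contains the
least-prime bound `p ≪ |d_N|^{L}` with `Frob_p = C` (Linnik–Chebotarev, [LagariasMontgomeryOdlyzko1979, Thm. 1.1])
as the case `h = x`.
-/

noncomputable section

open scoped NumberField nonZeroDivisors Classical
open Finset Real Ideal NumberField IsDedekindDomain
open Literature.NumberTheory.NumberFields Literature.NumberTheory.LFunctions
  Literature.NumberTheory.LFunctions.NumberField Literature.NumberTheory.GaloisRepresentations

namespace Summit.QuantumAdvantage.QuantumAdvantage.Theorems.DegreeOnePrimesEscape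

/-- If the `log`-weighted count of the primes `p ≤ y` with property `P` strictly increases from `y = x` to
`y = x + h`, there is a prime `p ∈ (x, x+h]` with `P p`. -/
theorem exists_prime_of_logSum_lt {P : ℕ → Prop} [DecidablePred P] {x h : ℝ} (hx : 0 ≤ x) (hh : 0 ≤ h)
    (hlt : (∑ p ∈ (Nat.primesLE ⌊x⌋₊).filter P, Real.log p) <
      ∑ p ∈ (Nat.primesLE ⌊x + h⌋₊).filter P, Real.log p) :
    ∃ p : ℕ, p.Prime ∧ x < p ∧ (p : ℝ) ≤ x + h ∧ P p := by
  have hsub : (Nat.primesLE ⌊x⌋₊).filter P ⊆ (Nat.primesLE ⌊x + h⌋₊).filter P := by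
    intro p hp
    rw [Finset.mem_filter, Nat.primesLE_eq_filter_range, Finset.mem_filter, Finset.mem_range] at hp ⊢
    refine ⟨⟨?_, hp.1.2⟩, hp.2⟩
    have : ⌊x⌋₊ ≤ ⌊x + h⌋₊ := Nat.floor_le_floor (by linarith)
    omega
  have hS : 0 < ∑ p ∈ (Nat.primesLE ⌊x + h⌋₊).filter P \ (Nat.primesLE ⌊x⌋₊).filter P, Real.log p := by
    rw [← Finset.sum_sdiff hsub] at hlt; linarith
  obtain ⟨p, hp, -⟩ := Finset.exists_ne_zero_of_sum_ne_zero hS.ne'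
  rw [Finset.mem_sdiff, Finset.mem_filter, Nat.primesLE_eq_filter_range, Finset.mem_filter, Finset.mem_range] at hp
  obtain ⟨⟨⟨hple, hprime⟩, hPp⟩, hnot⟩ := hp
  have hpgt : ⌊x⌋₊ < p := by
    by_contra hle
    push Not at hle
    exact hnot (by
      rw [Finset.mem_filter, Nat.primesLE_eq_filter_range, Finset.mem_filter, Finset.mem_range]
      exact ⟨⟨by omega, hprime⟩, hPp⟩)
  refine ⟨p, hprime, Nat.lt_of_floor_lt hpgt, ?_, hPp⟩
  have : (p : ℝ) ≤ ⌊x + h⌋₊ := by exact_mod_cast Nat.le_of_lt_succ hple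
  exact this.trans (Nat.floor_le (by linarith))

/-- **Every short interval `(x, x+h]` of the Linnik range (`x ≥ |d_N|^L`, `x^{1−δ} ≤ h ≤ x`) contains a prime
`p ∤ d_N` with `Frob_p ∈ C(σ)` — for EVERY class of EVERY Galois number field, unconditionally.**
[cite: LagariasMontgomeryOdlyzko1979, Theorem 1.1] [cite: Stark1974, Theorem 1'] -/
theorem exists_prime_frobenius_mem_shortInterval_all (n : ℕ) (hn : 1 < n) :
    ∃ δ L : ℝ, 0 < δ ∧ δ ≤ 1 / 64 ∧ 0 < L ∧
      ∀ (N : Type) [Field N] [NumberField N] [IsGalois ℚ N], Module.finrank ℚ N = n → ∀ σ : N ≃ₐ[ℚ] N,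
      ∀ x h : ℝ, ((NumberField.discr N).natAbs : ℝ) ^ L ≤ x → x ^ (1 - δ) ≤ h → h ≤ x →
        ∃ p : ℕ, p.Prime ∧ x < p ∧ (p : ℝ) ≤ x + h ∧ ¬ ((p : ℤ) ∣ NumberField.discr N) ∧
          ∃ (Q : Ideal (𝓞 N)) (_ : Q.IsMaximal) (_ : Q.LiesOver (span {(p : ℤ)})) (φ g : N ≃ₐ[ℚ] N),
            IsArithFrobAt ℤ φ Q ∧ Q.inertia (N ≃ₐ[ℚ] N) = ⊥ ∧ g * φ * g⁻¹ = σ := by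
  obtain ⟨δ, L, c, hδ0, hδ64, hL0, hc0, hc4, -, hmain⟩ :=
    frobeniusClass_shortInterval_dh n hn (κ := 1 / 2) (by norm_num) (by norm_num)
  refine ⟨δ, L, hδ0, hδ64, hL0, fun N _ _ _ hN σ x h hx hhx hhx' => ?_⟩
  obtain ⟨hA, hB⟩ := hmain N hN σ x h hx hhx hhx'
  have hN1 : 1 < Module.finrank ℚ N := by rw [hN]; exact hn
  have hd3 : (3 : ℝ) ≤ ((NumberField.discr N).natAbs : ℝ) := three_le_natAbs_discr_real N hN1
  have hx1 : 1 < x := by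
    have h1 : (3 : ℝ) ^ L ≤ ((NumberField.discr N).natAbs : ℝ) ^ L :=
      Real.rpow_le_rpow (by norm_num) hd3 hL0.le
    have h2 : (1 : ℝ) < (3 : ℝ) ^ L := Real.one_lt_rpow (by norm_num) hL0
    linarith
  have hx0 : 0 < x := by linarith
  have hh0 : 0 < h := lt_of_lt_of_le (Real.rpow_pos_of_pos hx0 _) hhx
  have hdC0 : 0 < (Nat.card {τ : N ≃ₐ[ℚ] N // IsConj σ τ} : ℝ) / Nat.card (N ≃ₐ[ℚ] N) := by
    have h1 : 0 < Nat.card {τ : N ≃ₐ[ℚ] N // IsConj σ τ} := by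
      haveI : Nonempty {τ : N ≃ₐ[ℚ] N // IsConj σ τ} := ⟨⟨σ, IsConj.refl σ⟩⟩
      exact Nat.card_pos
    have h2 : 0 < Nat.card (N ≃ₐ[ℚ] N) := Nat.card_pos
    exact div_pos (by exact_mod_cast h1) (by exact_mod_cast h2)
  set δC : ℝ := (Nat.card {τ : N ≃ₐ[ℚ] N // IsConj σ τ} : ℝ) / Nat.card (N ≃ₐ[ℚ] N) with hδC
  set P : ℕ → Prop := fun p : ℕ => ¬ ((p : ℤ) ∣ NumberField.discr N) ∧
    ∃ (Q : Ideal (𝓞 N)) (_ : Q.IsMaximal) (_ : Q.LiesOver (span {(p : ℤ)})) (φ g : N ≃ₐ[ℚ] N),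
      IsArithFrobAt ℤ φ Q ∧ Q.inertia (N ≃ₐ[ℚ] N) = ⊥ ∧ g * φ * g⁻¹ = σ with hP
  -- the count increases strictly across `(x, x+h]`
  have hlt : (∑ p ∈ (Nat.primesLE ⌊x⌋₊).filter P, Real.log p) <
      ∑ p ∈ (Nat.primesLE ⌊x + h⌋₊).filter P, Real.log p := by
    have hδCh : 0 < δC * h := mul_pos hdC0 hh0
    by_cases hz : ∃ β₁ : ℝ, dedekindZeta₁ N β₁ = 0 ∧
        1 - c / (Real.log ((NumberField.discr N).natAbs : ℝ) + Real.log 4) < β₁ ∧ β₁ < 1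
    · obtain ⟨β₁, hζ, hwin, hβ1⟩ := hz
      obtain ⟨hBp, hBm⟩ := hB β₁ hζ hwin hβ1
      have hβ0 : 0 < β₁ := by
        have hlogd : 0 < Real.log ((NumberField.discr N).natAbs : ℝ) := Real.log_pos (by linarith)
        have hlog4 : 1 < Real.log 4 := by
          rw [show (4:ℝ) = 2 ^ 2 by norm_num, Real.log_pow]; have := Real.log_two_gt_d9; push_cast; linarith
        have : c / (Real.log ((NumberField.discr N).natAbs : ℝ) + Real.log 4) ≤ 1 / 4 := by
          rw [div_le_iff₀ (by linarith)]; nlinarith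
        linarith
      by_cases hζE : dedekindZeta₁ (IntermediateField.fixedField (Subgroup.zpowers σ)) β₁ = 0
      · -- flat regime: relative error, and the flat main term is positive
        have hbd := (abs_le.1 (hBp hζE)).1
        have hflat := half_min_mul_le_flat hx1.le hh0.le hβ0 hβ1
        have hμ0 : 0 < min 1 ((1 - β₁) * Real.log x) :=
          lt_min one_pos (mul_pos (by linarith) (Real.log_pos hx1))
        have hpos : 0 < h - ((x + h) ^ β₁ - x ^ β₁) / β₁ := by nlinarith
        have hmain0 : 0 < δC * (h - ((x + h) ^ β₁ - x ^ β₁) / β₁) := mul_pos hdC0 hpos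
        linarith
      · have hbd := (abs_le.1 (hBm hζE)).1
        have hI := (rpow_window_div_mem hx1.le hh0.le hβ0 hβ1.le).1
        have := mul_nonneg hdC0.le hI
        have e : δC * (h + ((x + h) ^ β₁ - x ^ β₁) / β₁) = δC * h + δC * (((x + h) ^ β₁ - x ^ β₁) / β₁) := by
          ring
        linarith
    · have hbd := (abs_le.1 (hA hz)).1
      linarith
  obtain ⟨p, hprime, hxp, hpx, hPp⟩ := exists_prime_of_logSum_lt hx0.le hh0.le hlt
  exact ⟨p, hprime, hxp, hpx, hPp.1, hPp.2⟩

end Summit.QuantumAdvantage.QuantumAdvantage.Theorems.DegreeOnePrimesEscape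

end
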